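import Mathlib.Data.Set.Finite.Lattice
import Mathlib.Algebra.Order.BigOperators.Group.Finset
import Mathlib.Data.Int.Interval
import Mathlib.Data.Int.LeastGreatest
import Mathlib.Tactic.Linarith
import Mathlib.Tactic.Ring
import Mathlib.Tactic.Positivity
import HarnessLib

/-!
# A combinatorial lemma on twisted sums of finitely supported functions on `ℤ`

Topic `Literature/NumberTheory/GaloisRepresentations` (support for the proof of
Harris–Lan–Taylor–Thorne's Prop. 7.12, `HarrisLanTaylorThorne2016.prop712Hausdorff`, in
`TwistedSumDecompositionProofs`).  Everything here is elementary and fully proved; there are no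
definitions.

**The lemma** (`TwistedSum.exists_eq_add_shift`).  Let `ℳ ⊆ ℤ` be unbounded above and, for
`m ∈ ℳ`, let `p m : ℤ → ℤ` be non-negative with all finite partial sums `≤ B`, satisfying the
*three-term identity*
`p m₁ (n - m₂) + p m₂ (n - m₃) + p m₃ (n - m₁) = p m₁ (n - m₃) + p m₂ (n - m₁) + p m₃ (n - m₂)`
for all `m₁, m₂, m₃ ∈ ℳ`, `n ∈ ℤ`.  Then there are finitely supported non-negative
`q₁, q₂ : ℤ → ℤ` with `p m n = q₁ n + q₂ (n - m)` for all sufficiently large `m ∈ ℳ` and all `n`.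

*Where it comes from.*  In the proof of Prop. 7.12 one has semisimple representations `ρ_m`
(`m ∈ ℳ`) whose characters on a dense set are of the form `T₁ + μᵐ T₂`; for an irreducible `U`,
`p m n` is the multiplicity of the twist `U ⊗ μⁿ` in `ρ_m`.  The three-term identity is what
survives of "`ρ_m = ρ¹ ⊕ ρ² ⊗ μᵐ`" at the level of characters (it is the identity
`u^{m₂} P_{m₁} + u^{m₃} P_{m₂} + u^{m₁} P_{m₃} = u^{m₃} P_{m₁} + u^{m₁} P_{m₂} + u^{m₂} P_{m₃}`
of the generating Laurent polynomials `P_m = ∑ₙ p m n uⁿ`, automatic when `P_m = Q₁ + uᵐ Q₂`),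
the bound `B` is `dim ρ_m`, and the conclusion reconstructs the multiplicities of `ρ¹`, `ρ²`.
This replaces the algebraic-group argument (central torus of the reductive Zariski closure,
Lemma 7.7 – Cor. 7.11) of the source, which Mathlib cannot presently express.

*Proof.*  Fix `m₁ < m₀` in `ℳ`, `n₀ = m₀ - m₁`.  The identity with `(m, m₀, m₁)` reads
`p m n - p m (n + n₀) = g n + h (n + m₀ - m)` with `g`, `h` supported in a fixed window
(`exists_forall_lt_abs_eq_zero`: bounded partial sums force bounded support).  Hence `p m` is
`n₀`-periodic away from two windows, around `0` and around `m - m₀`; periodicity plus finite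
support kills `p m` below and above them (`eq_zero_of_periodic_below/above`), and periodicity plus
the mass bound kills it between them once they are `≥ B n₀` apart (`eq_zero_of_periodic_on`).
Comparing two large indices `m ≤ m'` the same way shows that the two window restrictions do not
depend on `m`; they are `q₁` and (shifted) `q₂`.  The degenerate case
`p m₀ = p m₁ = 0 ⇒ p m = 0` is `eq_zero_of_three_term`.
-/

namespace Literature.NumberTheory.GaloisRepresentations

namespace TwistedSum

/-- Iterating a one-step periodicity valid above `a`. [folklore] -/
theorem apply_eq_apply_add_mul_of_periodic_above {x : ℤ → ℤ} {n₀ a : ℤ} (hn₀ : 0 < n₀)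
    (hx : ∀ n, a ≤ n → x n = x (n + n₀)) (j : ℕ) : ∀ n, a ≤ n → x n = x (n + j * n₀) := by
  induction j with
  | zero => intro n _; simp
  | succ j ih =>
    intro n hn
    have h1 : a ≤ n + j * n₀ := by
      have : (0 : ℤ) ≤ j * n₀ := by positivity
      linarith
    rw [ih n hn, hx _ h1, Nat.cast_succ]
    ring_nf

/-- A finitely supported function which is `n₀`-periodic above `a` vanishes above `a`.
[folklore] -/
theorem eq_zero_of_periodic_above {x : ℤ → ℤ} {n₀ A a : ℤ} (hn₀ : 0 < n₀)
    (hx0 : ∀ n, A < |n| → x n = 0) (hx : ∀ n, a ≤ n → x n = x (n + n₀)) :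
    ∀ n, a ≤ n → x n = 0 := by
  intro n hn
  obtain ⟨j, hj⟩ : ∃ j : ℕ, A < n + j * n₀ := by
    refine ⟨(|A| + |n| + 1).toNat, ?_⟩
    have h1 : |A| + |n| + 1 ≤ ((|A| + |n| + 1).toNat : ℤ) := Int.self_le_toNat _
    have h2 : ((|A| + |n| + 1).toNat : ℤ) ≤ ((|A| + |n| + 1).toNat : ℤ) * n₀ :=
      le_mul_of_one_le_right (by positivity) hn₀
    have h3 : A ≤ |A| := le_abs_self A
    have h4 : -|n| ≤ n := neg_abs_le n
    linarith
  rw [apply_eq_apply_add_mul_of_periodic_above hn₀ hx j n hn]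
  exact hx0 _ (lt_of_lt_of_le hj (le_abs_self _))

/-- Iterating a one-step periodicity valid below `b`, downwards. [folklore] -/
theorem apply_sub_mul_eq_apply_of_periodic_below {x : ℤ → ℤ} {n₀ b : ℤ} (hn₀ : 0 < n₀)
    (hx : ∀ n, n ≤ b → x n = x (n + n₀)) (j : ℕ) : ∀ n, n ≤ b + n₀ → x (n - j * n₀) = x n := by
  induction j with
  | zero => intro n _; simp
  | succ j ih =>
    intro n hn
    have h1 : n - (j + 1 : ℕ) * n₀ ≤ b := by
      have : (0 : ℤ) ≤ j * n₀ := by positivity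
      push_cast
      linarith
    rw [hx _ h1, ← ih n hn, Nat.cast_succ]
    ring_nf

/-- A finitely supported function which is `n₀`-periodic below `b` vanishes below `b + n₀`.
[folklore] -/
theorem eq_zero_of_periodic_below {x : ℤ → ℤ} {n₀ A b : ℤ} (hn₀ : 0 < n₀)
    (hx0 : ∀ n, A < |n| → x n = 0) (hx : ∀ n, n ≤ b → x n = x (n + n₀)) :
    ∀ n, n ≤ b + n₀ → x n = 0 := by
  intro n hn
  obtain ⟨j, hj⟩ : ∃ j : ℕ, A < -(n - j * n₀) := by
    refine ⟨(|A| + |n| + 1).toNat, ?_⟩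
    have h1 : |A| + |n| + 1 ≤ ((|A| + |n| + 1).toNat : ℤ) := Int.self_le_toNat _
    have h2 : ((|A| + |n| + 1).toNat : ℤ) ≤ ((|A| + |n| + 1).toNat : ℤ) * n₀ :=
      le_mul_of_one_le_right (by positivity) hn₀
    have h3 : A ≤ |A| := le_abs_self A
    have h4 : n ≤ |n| := le_abs_self n
    linarith
  rw [← apply_sub_mul_eq_apply_of_periodic_below hn₀ hx j n hn]
  exact hx0 _ (lt_of_lt_of_le hj (neg_le_abs _))

/-- A non-negative function of total mass `≤ B` which is `n₀`-periodic on a long enough interval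
`[a, b]` vanishes on `[a, b + n₀]`. [folklore] -/
theorem eq_zero_of_periodic_on {x : ℤ → ℤ} {n₀ a b : ℤ} {B : ℕ} (hn₀ : 0 < n₀)
    (hxnn : ∀ n, 0 ≤ x n) (hmass : ∀ s : Finset ℤ, ∑ n ∈ s, x n ≤ B)
    (hx : ∀ n, a ≤ n → n ≤ b → x n = x (n + n₀)) (hab : B * n₀ ≤ b - a + 1) :
    ∀ n, a ≤ n → n ≤ b + n₀ → x n = 0 := by
  by_contra! H
  -- a least counterexample
  obtain ⟨r, ⟨har, hrb, hr0⟩, hrmin⟩ :=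
    Int.exists_least_of_bdd (P := fun n => a ≤ n ∧ n ≤ b + n₀ ∧ x n ≠ 0)
      ⟨a, fun z hz => hz.1⟩ H
  -- it lies in the first period
  have hr : r < a + n₀ := by
    by_contra! hr'
    have h1 : a ≤ r - n₀ := by linarith
    have h2 : r - n₀ ≤ b := by linarith
    have h3 : x (r - n₀) = x r := by rw [hx _ h1 h2]; ring_nf
    have := hrmin (r - n₀) ⟨h1, by linarith, by rwa [h3]⟩
    linarith
  -- the chain `r, r + n₀, …, r + B n₀` consists of `B + 1` points where `x ≥ 1`
  have hchain : ∀ j : ℕ, j ≤ B → x (r + j * n₀) = x r := by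
    intro j hj
    have hx' : ∀ n, r ≤ n → n ≤ b → x n = x (n + n₀) := fun n hn hnb => hx n (har.trans hn) hnb
    induction j with
    | zero => simp
    | succ j ih =>
      have hjB : (j : ℤ) + 1 ≤ B := by exact_mod_cast hj
      have h0 : (0 : ℤ) ≤ j * n₀ := by positivity
      have h1 : r + j * n₀ ≤ b := by nlinarith
      rw [← ih (Nat.le_of_succ_le hj), hx _ (by linarith) h1, Nat.cast_succ]
      ring_nf
  have hxr : 1 ≤ x r := by have := hxnn r; omega
  let s : Finset ℤ := (Finset.range (B + 1)).image fun j : ℕ => r + j * n₀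
  have hinj : Function.Injective fun j : ℕ => r + (j : ℤ) * n₀ := by
    intro i j hij
    have : (i : ℤ) * n₀ = j * n₀ := by simpa using hij
    exact_mod_cast mul_right_cancel₀ hn₀.ne' this
  have hsum : ∑ n ∈ s, x n = (B + 1 : ℕ) * x r := by
    rw [Finset.sum_image fun i _ j _ h => hinj h]
    rw [Finset.sum_congr rfl fun j hj => hchain j (Nat.lt_succ_iff.mp (Finset.mem_range.mp hj))]
    simp
  have := hmass s
  rw [hsum] at this
  push_cast at this
  nlinarith


/-- A non-negative integer-valued function whose finite partial sums are bounded by `B` has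
finite (indeed bounded) support. [folklore] -/
theorem exists_forall_lt_abs_eq_zero {x : ℤ → ℤ} {B : ℕ} (hxnn : ∀ n, 0 ≤ x n)
    (hmass : ∀ s : Finset ℤ, ∑ n ∈ s, x n ≤ B) : ∃ A : ℤ, 0 ≤ A ∧ ∀ n, A < |n| → x n = 0 := by
  have hfin : {n : ℤ | x n ≠ 0}.Finite := by
    by_contra hinf
    obtain ⟨t, ht, htc⟩ := Set.Infinite.exists_subset_card_eq hinf (B + 1)
    have h1 : ∀ n ∈ t, 1 ≤ x n := by
      intro n hn
      have h := ht hn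
      simp only [Set.mem_setOf_eq] at h
      have := hxnn n
      omega
    have h2 : ((B + 1 : ℕ) : ℤ) ≤ ∑ n ∈ t, x n := by
      calc ((B + 1 : ℕ) : ℤ) = ∑ _n ∈ t, (1 : ℤ) := by simp [htc]
        _ ≤ ∑ n ∈ t, x n := Finset.sum_le_sum h1
    have h3 := hmass t
    push_cast at h2
    linarith
  obtain ⟨A, hA⟩ := (hfin.image fun n => |n|).bddAbove
  refine ⟨|A|, abs_nonneg A, fun n hn => ?_⟩
  by_contra h
  have : |n| ≤ A := hA ⟨n, h, rfl⟩
  have : A ≤ |A| := le_abs_self A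
  linarith


/-- **Degenerate case of the three-term identity.**  If `p m₀` and `p m₁` vanish identically for
two distinct indices `m₀, m₁ ∈ ℳ`, then every `p m` (`m ∈ ℳ`) vanishes identically: the
identity with `(m, m₀, m₁)` makes `p m` periodic, and it is finitely supported. [folklore] -/
theorem eq_zero_of_three_term (ℳ : Set ℤ) (B : ℕ) (p : ℤ → ℤ → ℤ)
    (hp0 : ∀ m ∈ ℳ, ∀ n, 0 ≤ p m n) (hmass : ∀ m ∈ ℳ, ∀ s : Finset ℤ, ∑ n ∈ s, p m n ≤ B)
    (h3 : ∀ m₁ ∈ ℳ, ∀ m₂ ∈ ℳ, ∀ m₃ ∈ ℳ, ∀ n : ℤ,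
      p m₁ (n - m₂) + p m₂ (n - m₃) + p m₃ (n - m₁) =
        p m₁ (n - m₃) + p m₂ (n - m₁) + p m₃ (n - m₂))
    {m₀ m₁ : ℤ} (hm₀ : m₀ ∈ ℳ) (hm₁ : m₁ ∈ ℳ) (hne : m₀ ≠ m₁) (h₀ : ∀ n, p m₀ n = 0)
    (h₁ : ∀ n, p m₁ n = 0) : ∀ m ∈ ℳ, ∀ n, p m n = 0 := by
  -- arrange `m₁' < m₀'`
  obtain ⟨m₀', m₁', hm₀', hm₁', hlt, h₀', h₁'⟩ : ∃ m₀' m₁' : ℤ, m₀' ∈ ℳ ∧ m₁' ∈ ℳ ∧ m₁' < m₀' ∧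
      (∀ n, p m₀' n = 0) ∧ ∀ n, p m₁' n = 0 := by
    rcases lt_or_gt_of_ne hne with h | h
    · exact ⟨m₁, m₀, hm₁, hm₀, h, h₁, h₀⟩
    · exact ⟨m₀, m₁, hm₀, hm₁, h, h₀, h₁⟩
  intro m hm n
  obtain ⟨A, -, hA⟩ := exists_forall_lt_abs_eq_zero (hp0 m hm) (hmass m hm)
  have hx : ∀ n', n ≤ n' → p m n' = p m (n' + (m₀' - m₁')) := by
    intro n' _
    have := h3 m hm m₀' hm₀' m₁' hm₁' (n' + m₀')
    simp only [h₀', h₁', add_zero] at this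
    have e1 : n' + m₀' - m₀' = n' := by ring
    have e2 : n' + m₀' - m₁' = n' + (m₀' - m₁') := by ring
    rw [e1, e2] at this
    exact this
  exact eq_zero_of_periodic_above (by omega) hA hx n le_rfl

/-- **The combinatorial lemma on twisted sums.**  Let `ℳ ⊆ ℤ` be unbounded above and, for
`m ∈ ℳ`, let `p m : ℤ → ℤ` be non-negative with all finite partial sums `≤ B`.  Assume the
*three-term identity*
`p m₁ (n - m₂) + p m₂ (n - m₃) + p m₃ (n - m₁) = p m₁ (n - m₃) + p m₂ (n - m₁) + p m₃ (n - m₂)`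
for all `m₁, m₂, m₃ ∈ ℳ` and `n ∈ ℤ` (it says that the formal Laurent series
`P_m = ∑ p m n uⁿ` satisfy `u^{m₂} P_{m₁} + u^{m₃} P_{m₂} + u^{m₁} P_{m₃} = u^{m₃} P_{m₁} +
u^{m₁} P_{m₂} + u^{m₂} P_{m₃}`, as they do when `P_m = Q₁ + u^m Q₂`).  Then there are finitely
supported non-negative `q₁ q₂ : ℤ → ℤ` with `p m n = q₁ n + q₂ (n - m)` for all sufficiently
large `m ∈ ℳ` and all `n`.  (This is the combinatorial heart of our proof of
Harris–Lan–Taylor–Thorne's Prop. 7.12; it replaces the torus argument Lemma 7.7 – Cor. 7.11 of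
the source.) [folklore] -/
theorem exists_eq_add_shift (ℳ : Set ℤ) (hℳ : ∀ N : ℤ, ∃ m ∈ ℳ, N ≤ m) (B : ℕ)
    (p : ℤ → ℤ → ℤ) (hp0 : ∀ m ∈ ℳ, ∀ n, 0 ≤ p m n)
    (hmass : ∀ m ∈ ℳ, ∀ s : Finset ℤ, ∑ n ∈ s, p m n ≤ B)
    (h3 : ∀ m₁ ∈ ℳ, ∀ m₂ ∈ ℳ, ∀ m₃ ∈ ℳ, ∀ n : ℤ,
      p m₁ (n - m₂) + p m₂ (n - m₃) + p m₃ (n - m₁) =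
        p m₁ (n - m₃) + p m₂ (n - m₁) + p m₃ (n - m₂)) :
    ∃ (q₁ q₂ : ℤ → ℤ) (A M : ℤ), (∀ n, 0 ≤ q₁ n) ∧ (∀ n, 0 ≤ q₂ n) ∧
      (∀ n, A < |n| → q₁ n = 0) ∧ (∀ n, A < |n| → q₂ n = 0) ∧
      ∀ m ∈ ℳ, M ≤ m → ∀ n, p m n = q₁ n + q₂ (n - m) := by
  -- two reference indices `m₁ < m₀` in `ℳ`, `n₀ = m₀ - m₁ > 0`
  obtain ⟨m₁, hm₁, -⟩ := hℳ 0
  obtain ⟨m₀, hm₀, hm₀₁⟩ := hℳ (m₁ + 1)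
  set n₀ : ℤ := m₀ - m₁ with hn₀_def
  have hn₀ : 0 < n₀ := by omega
  -- a common support bound `A` for `p m₀`, `p m₁`
  obtain ⟨A0, hA0, hA0'⟩ := exists_forall_lt_abs_eq_zero (hp0 m₀ hm₀) (hmass m₀ hm₀)
  obtain ⟨A1', hA1', hA1''⟩ := exists_forall_lt_abs_eq_zero (hp0 m₁ hm₁) (hmass m₁ hm₁)
  set A : ℤ := max A0 A1' with hA_def
  have hA : 0 ≤ A := hA0.trans (le_max_left _ _)
  have hpA0 : ∀ n, A < |n| → p m₀ n = 0 := fun n hn => hA0' n ((le_max_left _ _).trans_lt hn)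
  have hpA1 : ∀ n, A < |n| → p m₁ n = 0 := fun n hn => hA1'' n ((le_max_right _ _).trans_lt hn)
  -- the difference functions `g`, `h` and the basic identity (Δ)
  set g : ℤ → ℤ := fun n => p m₁ n - p m₀ (n + n₀) with hg_def
  set h : ℤ → ℤ := fun n => p m₀ n - p m₁ n with hh_def
  set A₁ : ℤ := A + n₀ with hA₁_def
  have hgA : ∀ n, A₁ < |n| → g n = 0 := by
    intro n hn
    have h1 : A < |n| := by
      have : |n| ≤ |n| + n₀ := by linarith
      linarith
    have h2 : A < |n + n₀| := by
      rcases abs_cases (n + n₀) with ⟨h, _⟩ | ⟨h, _⟩ <;> rcases abs_cases n with ⟨h', _⟩ | ⟨h', _⟩ <;>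
        omega
    simp [hg_def, hpA1 n h1, hpA0 _ h2]
  have hhA : ∀ n, A₁ < |n| → h n = 0 := by
    intro n hn
    have h1 : A < |n| := by linarith
    simp [hh_def, hpA1 n h1, hpA0 n h1]
  have hΔ : ∀ m ∈ ℳ, ∀ n, p m n - p m (n + n₀) = g n + h (n + m₀ - m) := by
    intro m hm n
    have := h3 m hm m₀ hm₀ m₁ hm₁ (n + m₀)
    simp only [hg_def, hh_def, hn₀_def]
    have e1 : n + m₀ - m₀ = n := by ring
    have e2 : n + m₀ - m₁ = n + (m₀ - m₁) := by ring
    rw [e1, e2] at this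
    linarith
  -- finite support of every `p m`
  have hsupp : ∀ m ∈ ℳ, ∃ A' : ℤ, ∀ n, A' < |n| → p m n = 0 := fun m hm =>
    let ⟨A', _, h⟩ := exists_forall_lt_abs_eq_zero (hp0 m hm) (hmass m hm); ⟨A', h⟩
  -- the threshold on `m - m₀`
  set C : ℤ := 2 * A₁ + n₀ + 1 + B * n₀ with hC_def
  have hBn₀ : (0 : ℤ) ≤ B * n₀ := by positivity
  -- Step 3a: nothing below `-A`
  have hlow : ∀ m ∈ ℳ, m₀ ≤ m → ∀ n, n < -A → p m n = 0 := by
    intro m hm hmm₀ n hn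
    obtain ⟨A', hA'⟩ := hsupp m hm
    have hx : ∀ n, n ≤ -A₁ - 1 → p m n = p m (n + n₀) := by
      intro n hn'
      have h1 : g n = 0 := hgA n (by rw [abs_of_neg (by linarith)]; linarith)
      have h2 : h (n + m₀ - m) = 0 := hhA _ (by rw [abs_of_neg (by linarith)]; linarith)
      have := hΔ m hm n
      rw [h1, h2, add_zero] at this
      linarith
    exact eq_zero_of_periodic_below hn₀ hA' hx n (by linarith)
  -- Step 3b: nothing above `m - m₀ + A₁`
  have hhigh : ∀ m ∈ ℳ, m₀ ≤ m → ∀ n, m - m₀ + A₁ < n → p m n = 0 := by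
    intro m hm hmm₀ n hn
    obtain ⟨A', hA'⟩ := hsupp m hm
    have hx : ∀ n, m - m₀ + A₁ + 1 ≤ n → p m n = p m (n + n₀) := by
      intro n hn'
      have h1 : g n = 0 := hgA n (by rw [abs_of_pos (by linarith)]; linarith)
      have h2 : h (n + m₀ - m) = 0 := hhA _ (by rw [abs_of_pos (by linarith)]; linarith)
      have := hΔ m hm n
      rw [h1, h2, add_zero] at this
      linarith
    exact eq_zero_of_periodic_above hn₀ hA' hx n (by linarith)
  -- Step 3c: nothing in the middle, for `C ≤ m - m₀`
  have hmid : ∀ m ∈ ℳ, C ≤ m - m₀ → ∀ n, A₁ < n → n < m - m₀ - A₁ + n₀ → p m n = 0 := by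
    intro m hm hCm n hn hn'
    have hx : ∀ n, A₁ + 1 ≤ n → n ≤ m - m₀ - A₁ - 1 → p m n = p m (n + n₀) := by
      intro n h1n h2n
      have h1 : g n = 0 := hgA n (by rw [abs_of_pos (by linarith)]; linarith)
      have h2 : h (n + m₀ - m) = 0 := hhA _ (by rw [abs_of_neg (by linarith)]; linarith)
      have := hΔ m hm n
      rw [h1, h2, add_zero] at this
      linarith
    exact eq_zero_of_periodic_on hn₀ (hp0 m hm) (hmass m hm) hx (by linarith) n (by linarith)
      (by linarith)
  -- the two windows
  set L : ℤ → ℤ → ℤ := fun m n => if n ≤ A₁ then p m n else 0 with hL_def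
  set R : ℤ → ℤ → ℤ := fun m n => if -A₁ ≤ n then p m (n + (m - m₀)) else 0 with hR_def
  have hsplit : ∀ m ∈ ℳ, C ≤ m - m₀ → ∀ n, p m n = L m n + R m (n - (m - m₀)) := by
    intro m hm hCm n
    simp only [hL_def, hR_def]
    by_cases h1 : n ≤ A₁
    · rw [if_pos h1, if_neg (by linarith), add_zero]
    · rw [if_neg h1, zero_add]
      by_cases h2 : -A₁ ≤ n - (m - m₀)
      · rw [if_pos h2]; ring_nf
      · rw [if_neg h2]
        exact hmid m hm hCm n (by linarith) (by linarith)
  -- Step 4a: the left window does not depend on `m`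
  have hL : ∀ m ∈ ℳ, ∀ m' ∈ ℳ, C ≤ m - m₀ → m ≤ m' → L m = L m' := by
    intro m hm m' hm' hCm hmm'
    obtain ⟨A', hA'⟩ := hsupp m hm
    obtain ⟨A'', hA''⟩ := hsupp m' hm'
    -- `y = p m - p m'` is periodic below `m - m₀ - A₁ - 1`
    have hy0 : ∀ n, max A' A'' < |n| → p m n - p m' n = 0 := by
      intro n hn
      rw [hA' n ((le_max_left _ _).trans_lt hn), hA'' n ((le_max_right _ _).trans_lt hn), sub_zero]
    have hy : ∀ n, n ≤ m - m₀ - A₁ - 1 → p m n - p m' n = (p m (n + n₀) - p m' (n + n₀)) := by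
      intro n hn
      have h1 : h (n + m₀ - m) = 0 := hhA _ (by rw [abs_of_neg (by linarith)]; linarith)
      have h2 : h (n + m₀ - m') = 0 := hhA _ (by rw [abs_of_neg (by linarith)]; linarith)
      have e1 := hΔ m hm n
      have e2 := hΔ m' hm' n
      rw [h1] at e1
      rw [h2] at e2
      linarith
    have hy' := eq_zero_of_periodic_below hn₀ hy0 hy
    funext n
    simp only [hL_def]
    split_ifs with h1
    · have := hy' n (by linarith)
      linarith
    · rfl
  -- Step 4b: the right window does not depend on `m`
  have hR : ∀ m ∈ ℳ, ∀ m' ∈ ℳ, C ≤ m - m₀ → m ≤ m' → R m = R m' := by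
    intro m hm m' hm' hCm hmm'
    obtain ⟨A', hA'⟩ := hsupp m hm
    obtain ⟨A'', hA''⟩ := hsupp m' hm'
    -- `z n = p m (n + c) - p m' (n + c')` is periodic above `-A₁ - n₀`
    set z : ℤ → ℤ := fun n => p m (n + (m - m₀)) - p m' (n + (m' - m₀)) with hz_def
    have hz0 : ∀ n, max A' A'' + |m - m₀| + |m' - m₀| < |n| → z n = 0 := by
      intro n hn
      have hab1 : |n| ≤ |n + (m - m₀)| + |m - m₀| := by
        have e : n = (n + (m - m₀)) + (-(m - m₀)) := by ring
        have := abs_add_le (n + (m - m₀)) (-(m - m₀))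
        rw [abs_neg, ← e] at this
        exact this
      have hab2 : |n| ≤ |n + (m' - m₀)| + |m' - m₀| := by
        have e : n = (n + (m' - m₀)) + (-(m' - m₀)) := by ring
        have := abs_add_le (n + (m' - m₀)) (-(m' - m₀))
        rw [abs_neg, ← e] at this
        exact this
      have h1 : A' < |n + (m - m₀)| := by
        have := le_max_left A' A''; have := abs_nonneg (m' - m₀); linarith
      have h2 : A'' < |n + (m' - m₀)| := by
        have := le_max_right A' A''; have := abs_nonneg (m - m₀); linarith
      simp only [hz_def, hA' _ h1, hA'' _ h2, sub_zero]
    have hz : ∀ n, -A₁ - n₀ ≤ n → z n = z (n + n₀) := by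
      intro n hn
      have h1 : g (n + (m - m₀)) = 0 := hgA _ (by rw [abs_of_pos (by linarith)]; linarith)
      have h2 : g (n + (m' - m₀)) = 0 := hgA _ (by rw [abs_of_pos (by linarith)]; linarith)
      have e1 := hΔ m hm (n + (m - m₀))
      have e2 := hΔ m' hm' (n + (m' - m₀))
      rw [h1, zero_add] at e1
      rw [h2, zero_add] at e2
      have e3 : n + (m - m₀) + m₀ - m = n := by ring
      have e4 : n + (m' - m₀) + m₀ - m' = n := by ring
      rw [e3] at e1
      rw [e4] at e2
      simp only [hz_def]
      have e5 : n + n₀ + (m - m₀) = n + (m - m₀) + n₀ := by ring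
      have e6 : n + n₀ + (m' - m₀) = n + (m' - m₀) + n₀ := by ring
      rw [e5, e6]
      linarith
    have hz' := eq_zero_of_periodic_above hn₀ hz0 hz
    funext n
    simp only [hR_def]
    split_ifs with h1
    · have := hz' n (by linarith)
      simp only [hz_def] at this
      linarith
    · rfl
  -- Step 5: conclusion
  obtain ⟨ms, hms, hMms⟩ := hℳ (m₀ + C)
  refine ⟨L ms, fun j => R ms (j + m₀), A₁ + |m₀|, m₀ + C, ?_, ?_, ?_, ?_, ?_⟩
  · intro n
    simp only [hL_def]
    split_ifs
    · exact hp0 ms hms n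
    · exact le_rfl
  · intro j
    simp only [hR_def]
    split_ifs
    · exact hp0 ms hms _
    · exact le_rfl
  · intro n hn
    simp only [hL_def]
    split_ifs with h1
    · apply hlow ms hms (by linarith) n
      have : |m₀| ≥ 0 := abs_nonneg m₀
      rcases abs_cases n with ⟨h2, _⟩ | ⟨h2, _⟩ <;> linarith
    · rfl
  · intro j hj
    simp only [hR_def]
    split_ifs with h1
    · apply hhigh ms hms (by linarith)
      have h2 : |j| ≤ |j + m₀| + |m₀| := by
        have e : j = (j + m₀) + (-m₀) := by ring
        have := abs_add_le (j + m₀) (-m₀)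
        rw [abs_neg, ← e] at this
        exact this
      have h3 : A₁ < |j + m₀| := by linarith
      rcases abs_cases (j + m₀) with ⟨h4, _⟩ | ⟨h4, _⟩ <;> linarith
    · rfl
  · intro m hm hMm n
    have hCm : C ≤ m - m₀ := by linarith
    rw [hsplit m hm hCm n]
    rcases le_total m ms with hle | hle
    · rw [hL m hm ms hms hCm hle, hR m hm ms hms hCm hle]
      simp only [hR_def]
      have e : n - m + m₀ = n - (m - m₀) := by ring
      rw [e]
    · rw [← hL ms hms m hm (by linarith) hle, ← hR ms hms m hm (by linarith) hle]
      simp only [hR_def]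
      have e : n - m + m₀ = n - (m - m₀) := by ring
      rw [e]

end TwistedSum

end Literature.NumberTheory.GaloisRepresentations
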